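import Literature.NumberTheory.EllipticCurves.GreenbergSelmerNewform
import Literature.NumberTheory.EllipticCurves.EisensteinNewformLevelRaisingOrdinaryDescentProofs
import Literature.NumberTheory.EllipticCurves.EisensteinNewformLevelRaisingOrdinaryUnitRootSpecializationProofs
import Literature.NumberTheory.EllipticCurves.NewformGaloisRepThm61OfNewformProofs
import Literature.NumberTheory.EllipticCurves.NewformsLiftProofs
import Literature.NumberTheory.EllipticCurves.NewformsProofs
import Literature.NumberTheory.GaloisRepresentations.StableLatticeValuationRing
import HarnessLib

/-!
# The ordinary filtration of the integral model of a `p`-ordinary newform EXISTS (proofs only)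

A theorems-only companion (no definition, no named fact; D-0026) of `GreenbergSelmerNewform.lean`, which typed Emerton–Pollack–Weston's data for Greenberg's Selmer
group `Sel(ℚ_∞, A_f)` (Invent. Math. 163 (2006), §3.1, arXiv:math/0404484 p. 17): the integral
model `ρ_f : G_ℚ → GL₂(𝒪)` of a `p`-ordinary `p`-stabilised newform and, as the HYPOTHESIS STRUCTURE
`OrdinaryFiltration ρ v`, the `𝒪[G_p]`-stable line behind the exact sequence
"`0 → (K/𝒪)(ε^{k-1}χφ⁻¹) → A_f → (K/𝒪)(φ) → 0`" which EPW obtain "from (eq:ordes) and [Gross]",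
(eq:ordes) being "By [GS] the restriction of `ρ_f` to `G_p` is of the form `(ε^{k-1}χφ⁻¹ ∗; 0 φ)`
with `φ : G_p → 𝒪^×` the unramified character sending an arithmetic Frobenius to `a_p`" — Wiles,
Invent. Math. 94 (1988), Thm. 2.1.4 (p. 561) for `ρ_{f,λ}` over `K_{f,λ}` (the tree's named fact
`Literature.NumberTheory.EllipticCurves.Hida2000_thm326_ordinary`, Hida, *Modular Forms and Galois
Cohomology* (2000), Thm. 3.26 (2), p. 152, in its `ℚ̄_p`-form), made INTEGRAL by the lattice step of
Wiles's pp. 562–563 ("`(O_L)_P` is … a discrete valuation ring and hence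
`ρ_F(Gal(Q̄/Q)) ⊆ GL₂((O_L)_P)`"; the tree's `exists_integralFrame_of_frame`).  This file PROVES
that the datum exists, granted the tree's two named facts (Deligne's theorem at the places of the
coefficient field, `DeligneSerre1974.thm61_exists_adicGaloisRep`; Hida's Thm. 3.26 (2),
`Hida2000_thm326_ordinary`), so that consumers quantifying over
`(𝒪, F, ρ, P : OrdinaryFiltration ρ v_p)` (the X11a chain of the BSD residual cell,
`Summits/BirchSwinnertonDyer/Rank1Residual/X11a/ChainSocket.lean`) can instantiate their binders:

* `OrdinaryFiltration.exists_ofIntegralFrame` — over ANY commutative coefficient ring `𝒪`: an integral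
  frame `Q₀ ∈ GL₂(𝒪)` in which `ρ|_{Γ_{K_v}}` is upper triangular with lower-right entry `1` on the
  inertia group IS an ordinary filtration (`T⁺ = 𝒪 · Q₀e₀`, complement `𝒪 · Q₀e₁`, rank one,
  inertia acts trivially on `T/T⁺`) — Greenberg 1989, p. 98 (1)/(4), read on a basis.
* `OrdinaryFiltration.nonempty_of_frame` — over a valuation ring `O ⊆ F`: a RATIONAL such frame
  `Q ∈ GL₂(F)` of `ρ ⊗ F` suffices (Wiles 1988, pp. 562–563: the stable line saturates;
  `exists_integralFrame_of_frame`), and `OrdinaryFiltration.nonempty_of_frame_map`: so does a frame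
  over any field extension `f : F → B` provided some inertia element has upper-left entry `≠ 1`
  there (`exists_frame_descent`).
* `nonempty_ordinaryFiltration_of_thm326` — GRANTED `Hida2000_thm326_ordinary`: for a newform
  `g ∈ S_k(Γ₁(N))`, `k ≥ 2`, `p ∤ N`, `ι : ℚ̄_p ≃ ℂ` with `|ι⁻¹(a_p)|_p = 1`, ANY topological field
  `F` with a valuation subring `O` and a continuous `f : F → ℚ̄_p`, and any `ρ : Γ_ℚ → GL₂(O)` whose
  base change along `f ∘ (O ⊆ F)` is attached to `g` away from `N p` and irreducible, the integral
  representation `ρ` carries an `OrdinaryFiltration ρ w` at the place `w = p` — carrier-agnostic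
  (`(K_g)_v ⊇ 𝒪_v`, any finite `L ⊂ ℚ̄_p` with `𝒪_L`, `ℚ̄_p ⊇ ℤ̄_p`); the inertia witness is
  `ν(σ₀)^{k-1} ≠ 1` (`χ_p(I_{ℚ_p}) = ℤ_p^×`, tree).
* `nonempty_ordinaryFiltration_adicCompletionIntegers_of_thm326` — the `λ`-adic corollary
  (`F = (K_g)_v`, `O = 𝒪_v`, `ρ ⊗ (K_g)_v` attached through `K_g → (K_g)_v`; irreducibility is
  automatic by Ribet's Thm. (2.3), via the tree's `Hida2000_thm326_ordinary.exists_frame_adicCompletion`).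
* `exists_framedGaloisRep_adicCompletionIntegers_ordinaryFiltration` — GRANTED ALSO
  `DeligneSerre1974.thm61_exists_adicGaloisRep`: for `g`, `v ∋ p`, `p ∤ N`, `v(a_p) = 1` there IS a
  continuous `ρ : Γ_ℚ → GL₂(𝒪_v)` whose base change to `(K_g)_v` is attached to `g` away from
  `N p`, with `Nonempty (OrdinaryFiltration ρ w)` — EPW's "unique integral model … which we now
  fix" together with its sequence `0 → A'_f → A_f → A''_f → 0`, as an existence theorem (Serre's
  stable lattice, the tree's `exists_integralModel_of_valuationSubring`; `Γ_ℚ` compact, `𝒪_v` open).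

Nothing is asserted: every statement is proved, the two deep inputs enter as hypotheses
`(h : Hida2000_thm326_ordinary)`, `(h61 : thm61_exists_adicGaloisRep)` by name (net debt 0).  `Γ₀(M)`-newforms
enter through the tree's `liftToGamma1` (`isNewform1_liftToGamma1_iff_holds`,
`nebentypus_liftToGamma1_holds`, `coe_liftToGamma1_holds`).
-- TODO(general form): record that the arithmetic Frobenius acts on `T/T⁺` by the unit root `α`
-- of `X² − a_pX + χ(p)p^{k−1}` (needs `Hida2000_thm326_ordinary_unitRoot`); the Selmer group does
-- not use it.

## References

* M. Emerton, R. Pollack, T. Weston, *Variation of Iwasawa invariants in Hida families*, Invent.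
  Math. 163 (2006) 523–580, §3.1 ((eq:ordes) and the sequence `0 → A' → A → A'' → 0`).
  [EmertonPollackWeston2006]
* A. Wiles, *On ordinary `λ`-adic representations associated to modular forms*, Invent. Math. 94
  (1988) 529–573: Thm. 2.1.4 (p. 561); pp. 562–563 (the lattice step). [Wiles1988]
* R. Greenberg, *Iwasawa theory for `p`-adic representations*, Adv. Stud. Pure Math. 17 (1989)
  97–137, §1 p. 98 (1), (4). [Greenberg1989]
* H. Hida, *Modular Forms and Galois Cohomology*, CUP (2000), Thm. 3.26 (2), p. 152. [Hida2000]
* J.-P. Serre, *Abelian ℓ-adic representations and elliptic curves* (1968), Ch. I §1.1, Remark 1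
  (stable lattices). [SerreAbelianLadic1968]
* P. Deligne, J.-P. Serre, *Formes modulaires de poids 1*, Ann. Sci. ÉNS 7 (1974), Thm. 6.1.
  [DeligneSerreASENS1974]
-/

noncomputable section

open scoped MatrixGroups Matrix ModularForm NumberField

open NumberField IsDedekindDomain Field CongruenceSubgroup UpperHalfPlane Rat.HeightOneSpectrum
open Literature.NumberTheory.GaloisRepresentations
open Literature.NumberTheory.EllipticCurves.ModularForms

universe u

namespace Literature.NumberTheory.EllipticCurves.GreenbergSelmer

/-! ## §1. An integral ordinary frame is an ordinary filtration (any coefficient ring) -/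

section IntegralFrame

variable {K : Type u} [Field K] [NumberField K]
variable {𝒪 : Type u} [CommRing 𝒪]

/-- Column `j` of `R Q₀` read in the frame `Q₀`: `R (Q₀ e_j) = A_{0j} · Q₀e₀ + A_{1j} · Q₀e₁` with
`A = Q₀⁻¹ R Q₀` (the columns of `Q₀ A = R Q₀`).  Greenberg 1989, p. 98 (1): the filtration is
read on a basis of `T_p`. [cite: Greenberg1989, §1 p. 98 (1)] -/
theorem mulVec_frameCol_eq (R : Matrix (Fin 2) (Fin 2) 𝒪) (Q₀ : GL (Fin 2) 𝒪) (j : Fin 2) :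
    R *ᵥ (fun i ↦ (Q₀ : Matrix (Fin 2) (Fin 2) 𝒪) i j) =
      (((Q₀⁻¹ : GL (Fin 2) 𝒪) : Matrix (Fin 2) (Fin 2) 𝒪) * R * (Q₀ : Matrix (Fin 2) (Fin 2) 𝒪)) 0 j •
          (fun i ↦ (Q₀ : Matrix (Fin 2) (Fin 2) 𝒪) i 0) +
        (((Q₀⁻¹ : GL (Fin 2) 𝒪) : Matrix (Fin 2) (Fin 2) 𝒪) * R * (Q₀ : Matrix (Fin 2) (Fin 2) 𝒪)) 1 j •
          (fun i ↦ (Q₀ : Matrix (Fin 2) (Fin 2) 𝒪) i 1) := by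
  set A : Matrix (Fin 2) (Fin 2) 𝒪 :=
    ((Q₀⁻¹ : GL (Fin 2) 𝒪) : Matrix (Fin 2) (Fin 2) 𝒪) * R * (Q₀ : Matrix (Fin 2) (Fin 2) 𝒪) with hA
  have hQA : (Q₀ : Matrix (Fin 2) (Fin 2) 𝒪) * A = R * (Q₀ : Matrix (Fin 2) (Fin 2) 𝒪) := by
    rw [hA, ← mul_assoc, ← mul_assoc, ← Units.val_mul, mul_inv_cancel, Units.val_one, one_mul]
  ext i
  have hi := congrFun (congrFun hQA i) j
  simp only [Matrix.mul_apply, Fin.sum_univ_two] at hi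
  simp only [Matrix.mulVec, dotProduct, Fin.sum_univ_two, Pi.add_apply, Pi.smul_apply, smul_eq_mul]
  linear_combination -hi

/-- `Q₀⁻¹ (Q₀ e_j) = e_j`: the coordinates of the frame vectors in the frame (columns of
`Q₀⁻¹ Q₀ = 1`). [cite: Greenberg1989, §1 p. 98 (1)] -/
theorem inv_mulVec_frameCol (Q₀ : GL (Fin 2) 𝒪) (j : Fin 2) :
    ((Q₀⁻¹ : GL (Fin 2) 𝒪) : Matrix (Fin 2) (Fin 2) 𝒪) *ᵥ (fun i ↦ (Q₀ : Matrix (Fin 2) (Fin 2) 𝒪) i j) =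
      fun i ↦ (1 : Matrix (Fin 2) (Fin 2) 𝒪) i j := by
  have h1 : ((Q₀⁻¹ : GL (Fin 2) 𝒪) : Matrix (Fin 2) (Fin 2) 𝒪) * (Q₀ : Matrix (Fin 2) (Fin 2) 𝒪) = 1 := by
    rw [← Units.val_mul, inv_mul_cancel, Units.val_one]
  ext i
  have hi := congrFun (congrFun h1 i) j
  simp only [Matrix.mul_apply, Fin.sum_univ_two] at hi
  simp only [Matrix.mulVec, dotProduct, Fin.sum_univ_two]
  exact hi

/-- Every vector decomposes on the frame: `y = c₀ · Q₀e₀ + c₁ · Q₀e₁` with `c = Q₀⁻¹ y`.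
[cite: Greenberg1989, §1 p. 98 (1)] -/
theorem eq_frameCoords (Q₀ : GL (Fin 2) 𝒪) (y : Fin 2 → 𝒪) :
    y = (((Q₀⁻¹ : GL (Fin 2) 𝒪) : Matrix (Fin 2) (Fin 2) 𝒪) *ᵥ y) 0 •
          (fun i ↦ (Q₀ : Matrix (Fin 2) (Fin 2) 𝒪) i 0) +
        (((Q₀⁻¹ : GL (Fin 2) 𝒪) : Matrix (Fin 2) (Fin 2) 𝒪) *ᵥ y) 1 •
          (fun i ↦ (Q₀ : Matrix (Fin 2) (Fin 2) 𝒪) i 1) := by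
  set c : Fin 2 → 𝒪 := ((Q₀⁻¹ : GL (Fin 2) 𝒪) : Matrix (Fin 2) (Fin 2) 𝒪) *ᵥ y with hc
  have hy : (Q₀ : Matrix (Fin 2) (Fin 2) 𝒪) *ᵥ c = y := by
    rw [hc, Matrix.mulVec_mulVec, ← Units.val_mul, mul_inv_cancel, Units.val_one, Matrix.one_mulVec]
  conv_lhs => rw [← hy]
  ext i
  simp only [Matrix.mulVec, dotProduct, Fin.sum_univ_two, Pi.add_apply, Pi.smul_apply, smul_eq_mul]
  ring

/-- A scalar multiple of `Q₀e₀` equal to a scalar multiple of `Q₀e₁` has zero first coefficient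
(apply `Q₀⁻¹` and read the coordinate `0`). [cite: Greenberg1989, §1 p. 98 (1)] -/
theorem eq_zero_of_smul_frameCol_eq (Q₀ : GL (Fin 2) 𝒪) {t s : 𝒪}
    (h : t • (fun i ↦ (Q₀ : Matrix (Fin 2) (Fin 2) 𝒪) i 0) =
      s • (fun i ↦ (Q₀ : Matrix (Fin 2) (Fin 2) 𝒪) i 1)) : t = 0 := by
  have h' := congrArg (fun z ↦ (((Q₀⁻¹ : GL (Fin 2) 𝒪) : Matrix (Fin 2) (Fin 2) 𝒪) *ᵥ z) 0) h
  simp only [Matrix.mulVec_smul, inv_mulVec_frameCol, Pi.smul_apply, smul_eq_mul,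
    Matrix.one_apply_eq, Matrix.one_apply_ne (show (0 : Fin 2) ≠ 1 by decide), mul_one,
    mul_zero] at h'
  exact h'

variable [TopologicalSpace 𝒪] [Nontrivial 𝒪]

/-- **An integral ordinary frame is an ordinary filtration.**  Let `ρ : Γ_K → GL₂(𝒪)` be a framed
Galois representation (any commutative coefficient ring `𝒪`), `v` a finite place, and
`Q₀ ∈ GL₂(𝒪)` a frame in which every `ρ(σ)`, `σ ∈ Γ_{K_v}`, is upper triangular, with lower-right
entry `1` for `σ` in the inertia group.  Then `T⁺ := 𝒪 · Q₀e₀` is an `OrdinaryFiltration ρ v`: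
`Γ_{K_v}`-stable (`ρ(σ) Q₀e₀ = (Q₀⁻¹ρ(σ)Q₀)₀₀ · Q₀e₀`), with complement `𝒪 · Q₀e₁`, free of rank
one, and `ρ(σ) y − y ∈ T⁺` for `σ` in inertia (the frame of `ρ(σ) − 1` is `(∗ ∗; 0 0)`).  This is
Greenberg 1989, p. 98, (1)/(4) (`F⁺T_p = T_p ∩ F⁺V_p`, `F⁺A_p` its image) read on a basis adapted to
the filtration, and the shape (eq:ordes) of EPW §3.1 for the integral model.  Stated as the
existence of a filtration WITH the line `𝒪 · Q₀e₀` (the structure is built in the proof).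
[cite: Greenberg1989, §1 p. 98 (1), (4)] [cite: EmertonPollackWeston2006, §3.1 (eq:ordes)] -/
theorem OrdinaryFiltration.exists_ofIntegralFrame (ρ : FramedGaloisRep K 𝒪 2)
    (v : HeightOneSpectrum (𝓞 K)) (Q₀ : GL (Fin 2) 𝒪)
    (h10 : ∀ σ : absoluteGaloisGroup (v.adicCompletion K), (Q₀⁻¹ * ρ.toLocal v σ * Q₀).val 1 0 = 0)
    (h11 : ∀ σ ∈ absInertia (v.adicCompletion K), (Q₀⁻¹ * ρ.toLocal v σ * Q₀).val 1 1 = 1) :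
    ∃ P : OrdinaryFiltration ρ v,
      P.plus = Submodule.span 𝒪 {fun i ↦ (Q₀ : Matrix (Fin 2) (Fin 2) 𝒪) i 0} := by
  refine ⟨{ plus := Submodule.span 𝒪 {fun i ↦ (Q₀ : Matrix (Fin 2) (Fin 2) 𝒪) i 0}
            smul_mem := ?_, exists_isCompl := ?_, finrank_eq_one := ?_, unramified := ?_ }, rfl⟩
  · -- stability under the decomposition group
    intro σ y hy
    obtain ⟨t, rfl⟩ := Submodule.mem_span_singleton.mp hy
    have h := mulVec_frameCol_eq
      (((ρ (absGaloisRestrict K (v.adicCompletion K) σ) : GL (Fin 2) 𝒪) : Matrix (Fin 2) (Fin 2) 𝒪))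
      Q₀ 0
    have h0 : (((Q₀⁻¹ : GL (Fin 2) 𝒪) : Matrix (Fin 2) (Fin 2) 𝒪) *
        ((ρ (absGaloisRestrict K (v.adicCompletion K) σ) : GL (Fin 2) 𝒪) : Matrix (Fin 2) (Fin 2) 𝒪) *
        (Q₀ : Matrix (Fin 2) (Fin 2) 𝒪)) 1 0 = 0 := by
      simpa [Units.val_mul] using h10 σ
    rw [h0, zero_smul, add_zero] at h
    rw [FramedRep.toRepresentation_apply_apply, Matrix.mulVec_smul, h, smul_smul]
    exact Submodule.smul_mem _ _ (Submodule.mem_span_singleton_self _)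
  · -- the complement `𝒪 · Q₀e₁`
    refine ⟨Submodule.span 𝒪 {fun i ↦ (Q₀ : Matrix (Fin 2) (Fin 2) 𝒪) i 1}, isCompl_iff.mpr ⟨?_, ?_⟩⟩
    · rw [Submodule.disjoint_def]
      intro x hx0 hx1
      obtain ⟨t, rfl⟩ := Submodule.mem_span_singleton.mp hx0
      obtain ⟨s, hs⟩ := Submodule.mem_span_singleton.mp hx1
      rw [eq_zero_of_smul_frameCol_eq Q₀ hs.symm, zero_smul]
    · rw [codisjoint_iff, eq_top_iff]
      intro y _
      rw [eq_frameCoords Q₀ y]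
      exact Submodule.add_mem_sup (Submodule.smul_mem _ _ (Submodule.mem_span_singleton_self _))
        (Submodule.smul_mem _ _ (Submodule.mem_span_singleton_self _))
  · -- rank one
    have hli : LinearIndependent 𝒪 (fun _ : Fin 1 ↦ fun i ↦ (Q₀ : Matrix (Fin 2) (Fin 2) 𝒪) i 0) := by
      refine Fintype.linearIndependent_iff.mpr fun c hc i ↦ ?_
      simp only [Fin.sum_univ_one] at hc
      have h0 : c 0 = 0 :=
        eq_zero_of_smul_frameCol_eq Q₀ (s := 0) (by rw [hc, zero_smul])
      rwa [Subsingleton.elim i 0]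
    have h := finrank_span_eq_card hli
    rwa [Set.range_const, Fintype.card_fin] at h
  · -- the quotient is unramified
    intro σ hσ y
    set R : Matrix (Fin 2) (Fin 2) 𝒪 :=
      ((ρ (absGaloisRestrict K (v.adicCompletion K) σ) : GL (Fin 2) 𝒪) : Matrix (Fin 2) (Fin 2) 𝒪)
      with hR
    set A : Matrix (Fin 2) (Fin 2) 𝒪 :=
      ((Q₀⁻¹ : GL (Fin 2) 𝒪) : Matrix (Fin 2) (Fin 2) 𝒪) * R * (Q₀ : Matrix (Fin 2) (Fin 2) 𝒪) with hA
    have hA10 : A 1 0 = 0 := by simpa [hA, hR, Units.val_mul] using h10 σ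
    have hA11 : A 1 1 = 1 := by simpa [hA, hR, Units.val_mul] using h11 σ hσ
    set c : Fin 2 → 𝒪 := ((Q₀⁻¹ : GL (Fin 2) 𝒪) : Matrix (Fin 2) (Fin 2) 𝒪) *ᵥ y with hc
    have hq0 := mulVec_frameCol_eq R Q₀ 0
    have hq1 := mulVec_frameCol_eq R Q₀ 1
    rw [← hA] at hq0 hq1
    rw [hA10, zero_smul, add_zero] at hq0
    rw [hA11, one_smul] at hq1
    have key : R *ᵥ y - y = (c 0 * (A 0 0 - 1) + c 1 * A 0 1) •
        (fun i ↦ (Q₀ : Matrix (Fin 2) (Fin 2) 𝒪) i 0) := by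
      conv_lhs => rw [eq_frameCoords Q₀ y]
      rw [← hc, Matrix.mulVec_add, Matrix.mulVec_smul, Matrix.mulVec_smul, hq0, hq1]
      ext i
      simp only [Pi.sub_apply, Pi.add_apply, Pi.smul_apply, smul_eq_mul]
      ring
    rw [FramedRep.toRepresentation_apply_apply, ← hR, key]
    exact Submodule.smul_mem _ _ (Submodule.mem_span_singleton_self _)

end IntegralFrame

/-! ## §2. Over a valuation ring a rational ordinary frame suffices (Wiles 1988, pp. 562–563) -/

section ValuationRing

variable {K : Type u} [Field K] [NumberField K]
variable {F : Type u} [Field F] [TopologicalSpace F] (O : ValuationSubring F)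

/-- **A rational ordinary frame gives an ordinary filtration of the integral representation.**
Let `O ⊆ F` be a valuation subring, `ρ : Γ_K → GL₂(O)` a framed representation and
`Q ∈ GL₂(F)` a frame in which every `ρ(σ)`, `σ ∈ Γ_{K_v}`, is upper triangular over `F`, with
lower-right entry `1` on the inertia group.  Then `ρ` admits an `OrdinaryFiltration ρ v`:
the `F`-line `F · Qe₀` meets `O²` in a direct summand — Wiles's lattice step, *Invent. Math.*
94 (1988), pp. 562–563 (the tree's `exists_integralFrame_of_frame` supplies an integral frame
with the same diagonal), then `OrdinaryFiltration.exists_ofIntegralFrame`.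
[cite: Wiles1988, §2.2, pp. 562–563 (Thms. 2.2.1/2.2.2 ⇒ Thms. 2.1.2/2.1.4)] -/
theorem OrdinaryFiltration.nonempty_of_frame (ρ : FramedGaloisRep K O 2)
    (v : HeightOneSpectrum (𝓞 K)) (Q : GL (Fin 2) F)
    (h10 : ∀ σ : absoluteGaloisGroup (v.adicCompletion K),
      (Q⁻¹ * Matrix.GeneralLinearGroup.map O.subtype (ρ.toLocal v σ) * Q).val 1 0 = 0)
    (h11 : ∀ σ ∈ absInertia (v.adicCompletion K),
      (Q⁻¹ * Matrix.GeneralLinearGroup.map O.subtype (ρ.toLocal v σ) * Q).val 1 1 = 1) :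
    Nonempty (OrdinaryFiltration ρ v) := by
  obtain ⟨Q₀, hQ₀⟩ := exists_integralFrame_of_frame (fun σ ↦ ρ.toLocal v σ) Q h10
  obtain ⟨P, -⟩ := OrdinaryFiltration.exists_ofIntegralFrame ρ v Q₀ (fun σ ↦ (hQ₀ σ).1)
    fun σ hσ ↦ by
      have h : (((Q₀⁻¹ * ρ.toLocal v σ * Q₀).val 1 1 : O) : F) = 1 := by
        rw [(hQ₀ σ).2.2, h11 σ hσ]
      exact Subtype.ext h
  exact ⟨P⟩

/-- **… and so does a frame over any field extension, given an inertia element separating the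
diagonal.**  With `O ⊆ F` and `ρ` as above, let `f : F → B` be a field homomorphism and
`Q' ∈ GL₂(B)` a frame in which `ρ ⊗ B` is upper triangular on `Γ_{K_v}` with lower-right entry
`1` on inertia, and suppose some inertia element `σ₀` has upper-left entry `≠ 1` in that frame.
Then `ρ` admits an `OrdinaryFiltration ρ v`: the frame descends to `F` (the tree's
`exists_frame_descent`: the `B`-line is the kernel of `f(ρ(σ₀) − det ρ(σ₀))`, defined over `F`)
and `OrdinaryFiltration.nonempty_of_frame` applies.  (The use made of Wiles's Thm. 2.1.4 by EPW
§3.1 for the integral model over `𝒪 ⊂ K = ℚ_p(a_n)`, whatever the field over which the ordinary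
frame is first produced.) [cite: Wiles1988, Thm. 2.1.4 (p. 561) and §2.2, pp. 562–563]
[cite: EmertonPollackWeston2006, §3.1 (eq:ordes)] -/
theorem OrdinaryFiltration.nonempty_of_frame_map (ρ : FramedGaloisRep K O 2)
    (v : HeightOneSpectrum (𝓞 K)) {B : Type*} [Field B] (f : F →+* B) (Q' : GL (Fin 2) B)
    (h10 : ∀ σ : absoluteGaloisGroup (v.adicCompletion K),
      (Q'⁻¹ * Matrix.GeneralLinearGroup.map (f.comp O.subtype) (ρ.toLocal v σ) * Q').val 1 0 = 0)
    (h11 : ∀ σ ∈ absInertia (v.adicCompletion K),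
      (Q'⁻¹ * Matrix.GeneralLinearGroup.map (f.comp O.subtype) (ρ.toLocal v σ) * Q').val 1 1 = 1)
    {σ₀ : absoluteGaloisGroup (v.adicCompletion K)} (hσ₀ : σ₀ ∈ absInertia (v.adicCompletion K))
    (h00 : (Q'⁻¹ * Matrix.GeneralLinearGroup.map (f.comp O.subtype) (ρ.toLocal v σ₀) * Q').val 0 0 ≠ 1) :
    Nonempty (OrdinaryFiltration ρ v) := by
  simp only [Matrix.GeneralLinearGroup.map_comp, MonoidHom.comp_apply] at h10 h11 h00
  obtain ⟨Q, hQ⟩ := exists_frame_descent f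
    (fun σ ↦ Matrix.GeneralLinearGroup.map O.subtype (ρ.toLocal v σ)) Q' h10
    (i₀ := σ₀) (h11 σ₀ hσ₀) h00
  refine OrdinaryFiltration.nonempty_of_frame O ρ v Q (fun σ ↦ (hQ σ).1) fun σ hσ ↦ ?_
  have h := (hQ σ).2.2
  rw [h11 σ hσ, map_eq_one_iff f f.injective] at h
  exact h

end ValuationRing

/-! ## §3. Newforms: the filtration exists, granted Hida 2000 Thm. 3.26 (2) (Wiles 1988 Thm. 2.1.4) -/

section Newform

variable {N : ℕ} [NeZero N] {k : ℤ}

/-- **The integral Galois representation of a `p`-ordinary newform is ordinary at `p` — in ANY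
`p`-adic coefficient ring.**  Granted the named fact `Hida2000_thm326_ordinary` (Hida, *MFG*
Thm. 3.26 (2) = Wiles 1988, Thm. 2.1.4, `ℚ̄_p`-form): let `g ∈ S_k(Γ₁(N))` be a newform, `k ≥ 2`,
`p ∤ N`, `ι : ℚ̄_p ≃ ℂ` with `|ι⁻¹(a_p(g))|_p = 1`; let `F` be a topological field with a
valuation subring `O` and a continuous homomorphism `f : F → ℚ̄_p`, and `ρ : Γ_ℚ → GL₂(O)` a
framed representation whose base change along `f ∘ (O ⊆ F)` is attached to `g` through
`ι⁻¹ ∘ (K_g ⊆ ℂ)` away from `N p` and irreducible.  Then at the place `w = p` the integral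
representation `ρ` carries an `OrdinaryFiltration ρ w` — EPW §3.1's
"`0 → (K/𝒪)(ε^{k-1}χφ⁻¹) → A_f → (K/𝒪)(φ) → 0`" for `A_f = Cofree ρ F`.  Proof: the fact gives a
`ℚ̄_p`-frame with inertial diagonal `(ν^{k-1}, 1)`; as `χ_p(I_{ℚ_p}) = ℤ_p^×`
(`adicCompletion_rat_exists_mem_absInertia_cyclotomicCharacter_eq`) some `σ₀` in inertia has
`ν(σ₀)^{k-1} ≠ 1`; conclude by `OrdinaryFiltration.nonempty_of_frame_map` (descent to `F`,
saturation in `O²`). [cite: EmertonPollackWeston2006, §3.1 (eq:ordes)]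
[cite: Hida2000, Thm. 3.26 (2), p. 152] [cite: Wiles1988, Thm. 2.1.4 (p. 561), pp. 562–563] -/
theorem nonempty_ordinaryFiltration_of_thm326 (h : Hida2000_thm326_ordinary)
    {g : CuspForm (Gamma1 N) k} (hk : 2 ≤ k) (hg : IsNewform1 g) {p : ℕ} [Fact p.Prime]
    (ι : PadicAlgCl p ≃+* ℂ) (hpN : ¬ p ∣ N)
    (hap : Valued.v (ι.symm ((qExpansion 1 ⇑g).coeff p)) = 1)
    {F : Type} [Field F] [TopologicalSpace F] (O : ValuationSubring F)
    (f : F →+* PadicAlgCl p) (hfO : Continuous (f.comp O.subtype)) {ρ : FramedGaloisRep ℚ O 2}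
    (hρ : IsGaloisRepOfNewform1 g
      ((ι.symm : ℂ →+* PadicAlgCl p).comp (algebraMap (coeffCharField g) ℂ)) {q | q ∣ N * p}
      (FramedRep.baseChange (f.comp O.subtype) hfO ρ))
    (hirr : (FramedGaloisRep.toGaloisRep (FramedRep.baseChange (f.comp O.subtype) hfO ρ)).IsIrreducible)
    {w : HeightOneSpectrum (𝓞 ℚ)} (hw : (p : 𝓞 ℚ) ∈ w.asIdeal) :
    Nonempty (OrdinaryFiltration ρ w) := by
  obtain ⟨Q', hQ'⟩ := h g hk hg p ι hpN hap _ hρ hirr w hw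
  -- read the frame on `(f ∘ (O ⊆ F))(ρ|_{Γ_{ℚ_w}})`
  have hQ'' : ∀ σ,
      (Q'⁻¹ * Matrix.GeneralLinearGroup.map (f.comp O.subtype) (ρ.toLocal w σ) * Q').val 1 0 = 0 ∧
      (σ ∈ absInertia (w.adicCompletion ℚ) →
        (Q'⁻¹ * Matrix.GeneralLinearGroup.map (f.comp O.subtype) (ρ.toLocal w σ) * Q').val 1 1 = 1 ∧
        (Q'⁻¹ * Matrix.GeneralLinearGroup.map (f.comp O.subtype) (ρ.toLocal w σ) * Q').val 0 0 =
          algebraMap ℚ_[p] (PadicAlgCl p)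
            ((GaloisRep.cyclotomicCharacter (w.adicCompletion ℚ) p σ : ℤ_[p]) : ℚ_[p]) ^ (k - 1)) :=
    fun σ ↦ hQ' σ
  -- an inertia element with `ν^{k-1} ≠ 1`
  have hgen : ((primesEquiv w : Nat.Primes) : ℕ) = p := by
    have hdvd : natGenerator w ∣ p := (Rat.natCast_mem_asIdeal_iff w).mp hw
    exact (Nat.prime_dvd_prime_iff_eq (primesEquiv w).2 (Fact.out : p.Prime)).mp hdvd
  obtain ⟨u, hu⟩ := exists_unit_pow_ne_one p
  obtain ⟨σ₀, hσ₀, hνσ₀⟩ :=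
    adicCompletion_rat_exists_mem_absInertia_cyclotomicCharacter_eq p w hgen u
  have h00 : (Q'⁻¹ * Matrix.GeneralLinearGroup.map (f.comp O.subtype) (ρ.toLocal w σ₀) * Q').val 0 0
      ≠ 1 := by
    rw [((hQ'' σ₀).2 hσ₀).2, hνσ₀]
    obtain ⟨m, hm⟩ : ∃ m : ℕ, (m : ℤ) = k - 1 := ⟨(k - 1).toNat, Int.toNat_of_nonneg (by omega)⟩
    have hm0 : 0 < m := by omega
    rw [← hm, zpow_natCast, ← map_pow, Ne,
      map_eq_one_iff _ (algebraMap ℚ_[p] (PadicAlgCl p)).injective]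
    intro h1
    apply hu m hm0
    apply Units.ext
    apply PadicInt.ext
    rw [Units.val_pow_eq_pow_val, Units.val_one, PadicInt.coe_pow, PadicInt.coe_one]
    exact h1
  exact OrdinaryFiltration.nonempty_of_frame_map O ρ w f Q' (fun σ ↦ (hQ'' σ).1)
    (fun σ hσ ↦ ((hQ'' σ).2 hσ).1) hσ₀ h00

/-- **The `λ`-adic corollary: the integral model over `𝒪_v ⊂ (K_g)_v` is ordinary at `p`.**
Granted `Hida2000_thm326_ordinary`, for a newform `g ∈ S_k(Γ₁(N))`, `k ≥ 2`, a finite place `v`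
of `K_g` above `p ∤ N` with `v(a_p(g)) = 1` ("`f` ordinary at `λ`", Wiles) and any framed
`ρ : Γ_ℚ → GL₂(𝒪_v)` whose base change to `(K_g)_v` is attached to `g` through `K_g → (K_g)_v`
away from `N p`, there is an `OrdinaryFiltration ρ w` at the place `w = p` — EPW §3.1 in its own
carriers (`K = ℚ_p(a_n)`, `𝒪` its ring of integers).  Irreducibility is automatic (Ribet's
Thm. (2.3), proved in the tree); the `(K_g)_v`-rational frame is the tree's
`Hida2000_thm326_ordinary.exists_frame_adicCompletion`, then `nonempty_of_frame`.
[cite: EmertonPollackWeston2006, §3.1 (eq:ordes)] [cite: Wiles1988, Thm. 2.1.4 (p. 561), pp. 562–563] -/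
theorem nonempty_ordinaryFiltration_adicCompletionIntegers_of_thm326 (h : Hida2000_thm326_ordinary)
    {g : CuspForm (Gamma1 N) k} (hk : 2 ≤ k) (hg : IsNewform1 g) [NumberField (coeffCharField g)]
    (v : HeightOneSpectrum (𝓞 (coeffCharField g))) {p : ℕ} (hp : p.Prime)
    (hpv : ((p : ℕ) : 𝓞 (coeffCharField g)) ∈ v.asIdeal) (hpN : ¬ p ∣ N)
    (hord : v.valuation (coeffCharField g)
      ⟨(qExpansion 1 ⇑g).coeff p, cuspCoeff_mem_coeffCharField g p⟩ = 1)
    {w : HeightOneSpectrum (𝓞 ℚ)} (hw : (p : 𝓞 ℚ) ∈ w.asIdeal)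
    {ρ : FramedGaloisRep ℚ (v.adicCompletionIntegers (coeffCharField g)) 2}
    (hρ : IsGaloisRepOfNewform1 g
      (algebraMap (coeffCharField g) (v.adicCompletion (coeffCharField g))) {q | q ∣ N * p}
      (FramedRep.baseChange (v.adicCompletionIntegers (coeffCharField g)).subtype
        continuous_subtype_val ρ)) :
    Nonempty (OrdinaryFiltration ρ w) := by
  obtain ⟨Q, hQ⟩ := h.exists_frame_adicCompletion hk hg v hp hpv hpN hord hw hρ
  exact OrdinaryFiltration.nonempty_of_frame _ ρ w Q (fun σ ↦ (hQ σ).1) fun σ hσ ↦ (hQ σ).2 hσ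

/-! ## §4. Existence of the datum `(𝒪, ρ, T⁺)`, granted Deligne's theorem as well -/

/-- "Attached to `g`" is invariant under a change of frame `ρ ↦ P ρ P⁻¹` (`FramedRep.conj`):
unramifiedness (`FramedGaloisRep.isUnramifiedAt_conj_iff`) and the characteristic polynomials of
Frobenius (conjugate matrices, Mathlib `Matrix.charpoly_units_conj`) are invariants of the
isomorphism class (Deligne–Serre 1974, §6: the representation is determined up to isomorphism).
[cite: DeligneSerreASENS1974, Thm. 6.1, (6.1.1) (p. 520)] -/
theorem isGaloisRepOfNewform1_conj {A : Type*} [CommRing A] [TopologicalSpace A]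
    [IsTopologicalRing A] {g : CuspForm (Gamma1 N) k} {ιA : coeffCharField g →+* A} {S : Set ℕ}
    {ρ : FramedGaloisRep ℚ A 2} (P : GL (Fin 2) A) (h : IsGaloisRepOfNewform1 g ιA S ρ) :
    IsGaloisRepOfNewform1 g ιA S (FramedRep.conj P ρ) := by
  intro v hv
  refine ⟨(FramedGaloisRep.isUnramifiedAt_conj_iff v P ρ).mpr (h v hv).1, fun 𝔓 h𝔓 σ hσ ↦ ?_⟩
  have hc : FramedRep.charpoly (FramedRep.conj P ρ) σ = FramedRep.charpoly ρ σ := by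
    simp only [FramedRep.charpoly, FramedRep.conj_apply, Units.val_mul, Matrix.coe_units_inv]
    exact Matrix.charpoly_units_conj P _
  rw [hc]
  exact (h v hv).2 𝔓 h𝔓 σ hσ

/-- **The datum of EPW §3.1 exists** ("`ρ_f : G_ℚ → GL₂(𝒪)` … integral model … which we now fix"
and "an `𝒪[G_p]`-equivariant exact sequence `0 → A'_f → A_f → A''_f → 0`").  Granted the named
facts `DeligneSerre1974.thm61_exists_adicGaloisRep` (Deligne's theorem at every place; its
newform-places shape by the tree's `thm61_exists_adicGaloisRep_iff_newformPlaces`) and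
`Hida2000_thm326_ordinary`: for a newform `g ∈ S_k(Γ₁(N))`, `k ≥ 2`, a place `v` of `K_g` above
`p ∤ N` with `v(a_p(g)) = 1`, and the place `w = p` of `ℚ`, there is a continuous
`ρ : Γ_ℚ → GL₂(𝒪_v)` whose base change to `(K_g)_v` is attached to `g` through `K_g → (K_g)_v`
away from `N p`, together with an `OrdinaryFiltration ρ w`.  Proof: Deligne's `ρ_v` over
`(K_g)_v`; a `Γ_ℚ`-stable lattice (Serre I.1.1, the tree's `exists_integralModel_of_valuationSubring`:
`Γ_ℚ` is compact and `𝒪_v` is open), giving an integral `ρ` with `ρ ⊗ (K_g)_v = P⁻¹ρ_vP`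
(continuity of `ρ` from that of `P⁻¹ρ_vP`, `GL₂(𝒪_v) → GL₂((K_g)_v)` being an embedding), still
attached (`isGaloisRepOfNewform1_conj`); then `nonempty_ordinaryFiltration_adicCompletionIntegers_of_thm326`.
[cite: EmertonPollackWeston2006, §3.1] [cite: SerreAbelianLadic1968, Ch. I §1.1, Remark 1]
[cite: Wiles1988, Thm. 2.1.4 (p. 561), pp. 562–563] -/
theorem exists_framedGaloisRep_adicCompletionIntegers_ordinaryFiltration
    (h61 : DeligneSerre1974.thm61_exists_adicGaloisRep) (h : Hida2000_thm326_ordinary)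
    {g : CuspForm (Gamma1 N) k} (hk : 2 ≤ k) (hg : IsNewform1 g) [NumberField (coeffCharField g)]
    (v : HeightOneSpectrum (𝓞 (coeffCharField g))) {p : ℕ} (hp : p.Prime)
    (hpv : ((p : ℕ) : 𝓞 (coeffCharField g)) ∈ v.asIdeal) (hpN : ¬ p ∣ N)
    (hord : v.valuation (coeffCharField g)
      ⟨(qExpansion 1 ⇑g).coeff p, cuspCoeff_mem_coeffCharField g p⟩ = 1)
    {w : HeightOneSpectrum (𝓞 ℚ)} (hw : (p : 𝓞 ℚ) ∈ w.asIdeal) :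
    ∃ ρ : FramedGaloisRep ℚ (v.adicCompletionIntegers (coeffCharField g)) 2,
      IsGaloisRepOfNewform1 g
        (algebraMap (coeffCharField g) (v.adicCompletion (coeffCharField g))) {q | q ∣ N * p}
        (FramedRep.baseChange (v.adicCompletionIntegers (coeffCharField g)).subtype
          continuous_subtype_val ρ) ∧
      Nonempty (OrdinaryFiltration ρ w) := by
  set F := v.adicCompletion (coeffCharField g) with hF
  set O : ValuationSubring F := v.adicCompletionIntegers (coeffCharField g) with hO
  -- Deligne's representation over `(K_g)_v`
  obtain ⟨ρF, hρF⟩ :=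
    DeligneSerre1974.thm61_exists_adicGaloisRep_iff_newformPlaces.mp h61 hk hg v p hp hpv
  -- a stable lattice: an integral model `ρ₀` with `ρ₀ ⊗ F = P⁻¹ ρF P`
  have hOopen : IsOpen (O : Set F) := Valued.isOpen_valuationSubring F
  obtain ⟨P, ρ₀, hρ₀⟩ := exists_integralModel_of_valuationSubring (O := O) hOopen ρF
  -- `ρ₀` is continuous: `GL₂(O) → GL₂(F)` is an embedding and `σ ↦ P⁻¹ ρF(σ) P` is continuous
  have hcont : Continuous ρ₀ := by
    rw [(Topology.IsInducing.subtypeVal.generalLinearGroup_map (f := O.subtype)).continuous_iff]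
    have h1 : (Matrix.GeneralLinearGroup.map O.subtype ∘ ρ₀) = fun σ ↦ P⁻¹ * ρF σ * P :=
      funext fun σ ↦ hρ₀ σ
    rw [h1]
    exact (continuous_const.mul (map_continuous ρF)).mul continuous_const
  let ρ : FramedGaloisRep ℚ O 2 := ⟨ρ₀, hcont⟩
  -- its base change is the conjugate `P⁻¹ ρF P`, still attached to `g`
  have hbc : FramedRep.baseChange O.subtype continuous_subtype_val ρ = FramedRep.conj P⁻¹ ρF := by
    refine ContinuousMonoidHom.ext fun σ ↦ ?_
    rw [FramedRep.baseChange_apply, FramedRep.conj_apply, inv_inv]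
    exact hρ₀ σ
  have hρ : IsGaloisRepOfNewform1 g (algebraMap (coeffCharField g) F) {q | q ∣ N * p}
      (FramedRep.baseChange O.subtype continuous_subtype_val ρ) := by
    rw [hbc]
    exact isGaloisRepOfNewform1_conj P⁻¹ hρF
  exact ⟨ρ, hρ, nonempty_ordinaryFiltration_adicCompletionIntegers_of_thm326 h hk hg v hp hpv hpN
    hord hw hρ⟩

end Newform

/-! ## §5. The same for a `Γ₀(M)`-newform given with a `p`-adic embedding of its coefficient field
(the shape produced by `hida_exists_congruent_ordinary_newform_of_multiplicative`) -/

section GammaZero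

variable {M : ℕ} [NeZero M] {k : ℤ}

/-- **The coefficient field of a `Γ₁(N)`-newform is a number field** (Shimura 1971, Thm. 3.48;
Deligne–Serre 1974, (2.7.3): "Soit `K` une extension finie de `ℚ` contenant les `a_p` et les
`ε(p)`") — packaged as an instance-valued theorem from the tree's PROVED (2.7.2)
(`DeligneSerre1974_span_integralLattice1_holds`, `IsNewform1.finiteDimensional_coeffField_of_span_integralLattice1`)
and `DeligneSerre1974.finiteDimensional_coeffCharField` (the character values are roots of unity).
[cite: DeligneSerreASENS1974, Prop. 2.7 (2.7.2)–(2.7.3) (p. 512)] [cite: Shimura1971, Thm. 3.48] -/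
theorem numberField_coeffCharField_of_isNewform1 {N : ℕ} [NeZero N] {g : CuspForm (Gamma1 N) k}
    (hg : IsNewform1 g) : NumberField (coeffCharField g) := by
  haveI : FiniteDimensional ℚ (coeffField g) :=
    (IsNewform1.finiteDimensional_coeffField_of_span_integralLattice1
      (DeligneSerre1974_span_integralLattice1_holds N k)) hg
  haveI : FiniteDimensional ℚ (coeffCharField g) :=
    DeligneSerre1974.finiteDimensional_coeffCharField g
  exact NumberField.mk

/-- The same for the `Γ₁(M)`-lift of a `Γ₀(M)`-newform (`isNewform1_liftToGamma1_iff_holds`,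
Li 1975 §3 / Diamond–Shurman Thm. 5.8.2). [cite: DeligneSerreASENS1974, Prop. 2.7 (2.7.3) (p. 512)]
[cite: Li1975, §3] -/
theorem numberField_coeffCharField_liftToGamma1 {g : CuspForm (Gamma0 M) k} (hg : IsNewform0 g) :
    NumberField (coeffCharField (liftToGamma1 M k g)) :=
  numberField_coeffCharField_of_isNewform1 ((isNewform1_liftToGamma1_iff_holds M k g).mpr hg)

/-- For a non-zero `Γ₀(M)`-form `g`, the coefficient field with character values of its
`Γ₁(M)`-lift is contained in (indeed equals) `ℚ(a_n(g))`: the lift has the same `q`-expansion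
(`coe_liftToGamma1_holds`) and trivial nebentypus (`nebentypus_liftToGamma1_holds`, values `0, 1`)
— Diamond–Shurman §4.3, `S_k(Γ₀(N)) = S_k(N, 𝟙)`. [cite: DiamondShurman2005, §4.3 (S_k(Γ₀(N)) = S_k(N, 𝟙))] -/
theorem coeffCharField_liftToGamma1_le {g : CuspForm (Gamma0 M) k} (hg0 : g ≠ 0) :
    coeffCharField (liftToGamma1 M k g) ≤ coeffField g := by
  have hcoe : (⇑(liftToGamma1 M k g) : ℍ → ℂ) = ⇑g := coe_liftToGamma1_holds M k g
  have hε : nebentypus (liftToGamma1 M k g) = 1 := nebentypus_liftToGamma1_holds M k hg0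
  rw [coeffCharField, IntermediateField.adjoin_le_iff]
  rintro x (⟨n, rfl⟩ | ⟨n, rfl⟩)
  · dsimp only
    rw [hcoe]
    exact coeff_mem_coeffField g n
  · dsimp only
    rw [SetLike.mem_coe, hε]
    by_cases hu : IsUnit ((n : ℕ) : ZMod M)
    · rw [MulChar.one_apply hu]
      exact one_mem _
    · rw [MulChar.map_nonunit _ hu]
      exact zero_mem _

/-- **The datum `(𝒪, ρ, T⁺)` for a `Γ₀(M)`-newform with a `p`-adic embedding of its coefficient
field** — the shape in which the tree's `hida_exists_congruent_ordinary_newform_of_multiplicative`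
(EPW Thm. 2.1.2 / Hida) delivers the higher-weight member of a Hida family:
`g ∈ S_k(Γ₀(M))` a newform, `k ≥ 2`, `p ∤ M`, `ι : K_g = ℚ(a_n(g)) → ℚ̄_p` with `|ι(a_p(g))|_p = 1`.
Granted the named facts `DeligneSerre1974.thm61_exists_adicGaloisRep` and
`Hida2000_thm326_ordinary`, there are: the place `v ∋ p` of the coefficient field `K₁` of the
`Γ₁(M)`-lift `g₁` of `g` cut out by `ι` (`|ι r|_p < 1 ↔ r ∈ v`, Neukirch II §8), a CONTINUOUS
`φ : (K₁)_v → ℚ̄_p` with `φ(a_n(g₁)) = ι(a_n(g))` for every `n` (so `φ` extends `ι`), and a continuous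
integral `ρ : Γ_ℚ → GL₂(𝒪_v)` whose base change to `(K₁)_v` is attached to `g₁` through
`K₁ → (K₁)_v` away from `M p`, with `Nonempty (OrdinaryFiltration ρ w)` at the place `w = p`.
(Hence `ρ ⊗_φ ℚ̄_p` is attached to `g₁` through `φ ∘ (K₁ → (K₁)_v)`, which is `ι` on the
coefficients: `IsGaloisRepOfNewform1.baseChange`.)  EPW §3.1's `K = ℚ_p(a_n)`, `𝒪`, `ρ_f`,
`0 → A'_f → A_f → A''_f → 0` for the weight-`k` member.  The instance hypothesis
`[NumberField K₁]` is `numberField_coeffCharField_liftToGamma1 hg`.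
[cite: EmertonPollackWeston2006, §3.1 and Thm. 2.1.2] [cite: Wiles1988, Thm. 2.1.4 (p. 561), pp. 562–563]
[cite: NeukirchANT1999, Ch. II §8 (p. 160) with (8.1)–(8.2)] -/
theorem exists_framedGaloisRep_ordinaryFiltration_of_isNewform0
    (h61 : DeligneSerre1974.thm61_exists_adicGaloisRep) (h : Hida2000_thm326_ordinary)
    {g : CuspForm (Gamma0 M) k} (hk : 2 ≤ k) (hg : IsNewform0 g) {p : ℕ} [Fact p.Prime]
    (hpM : ¬ p ∣ M) (ι : coeffField g →+* PadicAlgCl p)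
    (hord : ‖ι ⟨(qExpansion 1 ⇑g).coeff p, coeff_mem_coeffField g p⟩‖ = 1)
    [NumberField (coeffCharField (liftToGamma1 M k g))]
    {w : HeightOneSpectrum (𝓞 ℚ)} (hw : (p : 𝓞 ℚ) ∈ w.asIdeal) :
    ∃ (v : HeightOneSpectrum (𝓞 (coeffCharField (liftToGamma1 M k g))))
      (φ : v.adicCompletion (coeffCharField (liftToGamma1 M k g)) →+* PadicAlgCl p)
      (ρ : FramedGaloisRep ℚ (v.adicCompletionIntegers (coeffCharField (liftToGamma1 M k g))) 2),
      ((p : ℕ) : 𝓞 (coeffCharField (liftToGamma1 M k g))) ∈ v.asIdeal ∧ Continuous φ ∧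
      (∀ n : ℕ, φ (algebraMap (coeffCharField (liftToGamma1 M k g))
          (v.adicCompletion (coeffCharField (liftToGamma1 M k g)))
          ⟨(qExpansion 1 ⇑(liftToGamma1 M k g)).coeff n,
            cuspCoeff_mem_coeffCharField (liftToGamma1 M k g) n⟩) =
        ι ⟨(qExpansion 1 ⇑g).coeff n, coeff_mem_coeffField g n⟩) ∧
      IsGaloisRepOfNewform1 (liftToGamma1 M k g)
        (algebraMap (coeffCharField (liftToGamma1 M k g))
          (v.adicCompletion (coeffCharField (liftToGamma1 M k g)))) {q | q ∣ M * p}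
        (FramedRep.baseChange (v.adicCompletionIntegers (coeffCharField (liftToGamma1 M k g))).subtype
          continuous_subtype_val ρ) ∧
      Nonempty (OrdinaryFiltration ρ w) := by
  classical
  -- (no `set g₁ := liftToGamma1 M k g`: a let-bound abbreviation makes instance search return the
  -- un-abbreviated `NumberField` instance and the ensuing comparison unfolds `coeffCharField`)
  have hg1 : IsNewform1 (liftToGamma1 M k g) := (isNewform1_liftToGamma1_iff_holds M k g).mpr hg
  have hg0 : g ≠ 0 := by
    intro h0
    have h1 : IsNormalized g := hg.2.2
    rw [IsNormalized, h0] at h1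
    simp [UpperHalfPlane.qExpansion_zero] at h1
  have hcoe : (⇑(liftToGamma1 M k g) : ℍ → ℂ) = ⇑g := coe_liftToGamma1_holds M k g
  have hle : coeffCharField (liftToGamma1 M k g) ≤ coeffField g := coeffCharField_liftToGamma1_le hg0
  -- `j = ι ∘ (K₁ ⊆ K_g)`
  set j : coeffCharField (liftToGamma1 M k g) →+* PadicAlgCl p :=
    ι.comp (IntermediateField.inclusion hle).toRingHom with hj
  have hjn : ∀ n : ℕ,
      j ⟨(qExpansion 1 ⇑(liftToGamma1 M k g)).coeff n,
        cuspCoeff_mem_coeffCharField (liftToGamma1 M k g) n⟩ =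
      ι ⟨(qExpansion 1 ⇑g).coeff n, coeff_mem_coeffField g n⟩ := by
    intro n
    have hval : (((IntermediateField.inclusion hle)
        ⟨(qExpansion 1 ⇑(liftToGamma1 M k g)).coeff n,
          cuspCoeff_mem_coeffCharField (liftToGamma1 M k g) n⟩ : coeffField g) : ℂ) =
        (qExpansion 1 ⇑g).coeff n := by
      rw [IntermediateField.coe_inclusion]
      change (qExpansion 1 ⇑(liftToGamma1 M k g)).coeff n = (qExpansion 1 ⇑g).coeff n
      rw [hcoe]
    rw [hj, RingHom.comp_apply]
    exact congrArg ι (Subtype.ext hval)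
  -- the place `v` of `K₁` cut out by `j`, and the continuous `φ : (K₁)_v → ℚ̄_p` extending `j`
  obtain ⟨v, hpv, hjv⟩ := exists_heightOneSpectrum_of_ringHom_padicAlgCl j
  obtain ⟨φ, hφc, hφj⟩ := exists_continuous_ringHom_adicCompletion_padicAlgCl j v hpv hjv
  -- `g₁` is ordinary at `v`: `v(a_p) = 1` from `|ι(a_p)|_p = 1`
  have hval1 : Valued.v (j ⟨(qExpansion 1 ⇑(liftToGamma1 M k g)).coeff p,
      cuspCoeff_mem_coeffCharField (liftToGamma1 M k g) p⟩) = 1 := by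
    rw [hjn p, PadicAlgCl.valuation_def, ← NNReal.coe_inj, coe_nnnorm, NNReal.coe_one]
    exact hord
  have hordv : v.valuation (coeffCharField (liftToGamma1 M k g))
      ⟨(qExpansion 1 ⇑(liftToGamma1 M k g)).coeff p,
        cuspCoeff_mem_coeffCharField (liftToGamma1 M k g) p⟩ = 1 :=
    (valued_eq_one_iff_valuation_eq_one j v hpv hjv _).mp hval1
  obtain ⟨ρ, hρ, hP⟩ := exists_framedGaloisRep_adicCompletionIntegers_ordinaryFiltration h61 h hk
    hg1 v Fact.out hpv hpM hordv hw
  exact ⟨v, φ, ρ, hpv, hφc, fun n ↦ (hφj _).trans (hjn n), hρ, hP⟩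

end GammaZero

end Literature.NumberTheory.EllipticCurves.GreenbergSelmer

end
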